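import Summits.FinalStateConjecture.FinalStateConjecture.Theses.LogTimeThreeAnnuli
import Summits.FinalStateConjecture.FinalStateConjecture.Theses.ExactKerrEnds
import Summits.FinalStateConjecture.FinalStateConjecture.Theorems.LogTimeThreeAnnuliSubconvergentEraGenericStubOrientationGaugeAbsorption
import Summits.FinalStateConjecture.FinalStateConjecture.Theorems.LogTimeThreeAnnuliSubconvergentEraGenericAlongKerrEnds
import Literature.Geometry.Lorentzian.QuasiFinalStateDecomposition
import Literature.Geometry.Lorentzian.TameGenericityDiagonal
import Literature.Geometry.Lorentzian.ExactKerrEnd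
import HarnessLib

/-!
# Crux `LogTimeThreeAnnuli.SubconvergentEraGeneric` (stmt-FinalStateConjecture-17490): the POINTWISE adapter
# "settled in the Statement's vocabulary at all orders ⇒ the crux's honest subconvergent era", and the crux from
# all-orders settling along censored Kerr-ended curves

Lead c4 of line `registered` (2026-08-17), `--supports` piece of stmt-FinalStateConjecture-17490.  The import map of the
crux built by leads c1–c3 (`…StubOrientationGaugeAbsorption`, `…OfCensoredOmegaLimit`, `…AlongKerrEnds`) lacked one
adapter: every natural PRODUCER of final-state information in this tree concludes in the STATEMENT's vocabulary — a
`FinalStateDecomposition` with sub-extremal holes, `Summit.FinalStateConjecture.HasExhaustiveCharts`,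
`Summit.FinalStateConjecture.IsFutureOriented` (convergent; chart-time orientation in the VECTOR form `dΨᵢ(Λᵢ V_{Mᵢ,aᵢ})`
future-directed) — whereas the crux consumes the ERA vocabulary (a `QuasiFinalStateDecomposition … 2 ⊤` with vacuous
closeness plus windowed eventual `ε`-closeness for every `k`, wandering member, `(M,a)`-uniform COVECTOR orientation).
This file proves, with no analysis:

* `era_of_settledAllOrders` — for ONE maximal development: a final state decomposition `d` of `O` with sub-extremal holes,
  `O = exteriorOf charted`, `RaysStayInClosure O`, `IsFutureOriented d`, honest exhaustive radii `Rᵢ` with causal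
  exhaustion, and convergence IN THE SAME CHARTS AT EVERY ORDER `k` (flat zone, fixed near zones, growing near zones)
  yields the crux's era verbatim: window `m₀ ≤ Mᵢ ≤ m₀⁻¹`, `|aᵢ| ≤ χ Mᵢ` read off the finitely many sub-extremal labels,
  `d.toQuasi` (charted / certified regions agree by `rfl`), member frozen at the label, and the covector orientation from
  the vector one by the landed cone lemma `symm_apply_zero_pos_of_isFutureDirected` at `C⁰`-tolerance `δ‖Λᵢ‖² < 1`.
  The proof is ORDER-BY-ORDER (the clause at order `k` uses convergence at order `k` only, the orientation clause order
  `0`), so any finite-order restatement of the crux inherits it verbatim.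
* `settled_of_settledAllOrders` — sanity: the all-orders settled clause implies the Statement's settled clause (`C²`).
* `alongCensoredKerrEnds_of_settlingAllOrdersAlongCensoredKerrEnds : C₂^∞ → C₂'` — where C₂' is the registered residual
  stub of the skeleton (crux-equivalent modulo E, C₁, p154553) and C₂^∞ is its all-orders-settling twin: along every tame
  curve of admissible data, immersed-injective or constant, whose members off `0` are Kerr-ended and censored and whose base
  datum is NOT settled at all orders, passes a tame injective immersed admissible curve through the same base datum whose
  members off `0` ARE settled at all orders (every MGHD: complete `𝓘⁺` ∧ the clause above) — the all-orders twin of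
  `Theses.ExactKerrEnds.SettlingAlongCensoredKerrEnds` (stmt-FinalStateConjecture-18520, `C²`), asked only through
  exceptional base data.
* `subconvergentEraGeneric_of_settlingAllOrdersAlongCensoredKerrEnds : TameEscapeToKerrEnds → CensorshipAlongKerrEnds →
  C₂^∞ → SubconvergentEraGeneric` — so the crux is fed, kernel-checked, by the two `ExactKerrEnds` items 18522, 18521 and
  ONE settling statement in the Statement's own vocabulary at all orders.

* (appended, lead c4 second pass) `era_upTo_of_settled` — the FINITE-ORDER form: the Statement-vocabulary settled clause at
  index `k₀ ≥ 2` (`FinalStateDecomposition 𝒟 O k₀`, `HasExhaustiveCharts`, `IsFutureOriented`) yields the era with its two `∀ k`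
  clauses capped at `k ≤ k₀` — the kernel-checked content of the finite-order repair `C′(K₀)` of the crux (at `K₀ = 2` the
  import is 18520-shaped); and `finalStateConjecture_of_settlingAllOrdersAlongCensoredKerrEnds : TameEscapeToKerrEnds →
  CensorshipAlongKerrEnds → C₂^∞ → MGHDExists → FinalStateConjecture` — ONE statement C₂^∞ feeds both this route's import crux
  and the sibling route's closure.

Not claimed: C₂^∞ (open problem: large-data settling for compactly supported deviations from exact Kerr ends, uniformly
along tame curves, at all orders); the converse C₂' → C₂^∞ (false direction in general: subconvergent ≠ convergent —
that upgrade is this route's `DyadicCapture`).  Sources: Dafermos–Luk arXiv:1710.01722 §1.2.1 and Conjecture 1;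
Klainerman, C. R. Mécanique 353 (2025) §2.3 (orbital versus asymptotic stability); O'Neill 1983 Ch. 5 Lemma 5.29;
Christodoulou, CQG 16 (1999) A23, p. A24.
-/

noncomputable section

-- the doubled `FinalStateConjecture` path component is the summit/problem naming scheme
set_option linter.dupNamespace false

namespace Summit.FinalStateConjecture.FinalStateConjecture.Theorems.LogTimeThreeAnnuli.SubconvergentEraGeneric

open scoped Manifold ContDiff Topology ENNReal
open Filter Set Function Literature.Geometry.Lorentzian
open Summit.FinalStateConjecture (HasCompleteNullInfinity exteriorOf RaysStayInClosure IsOrthochronous IsFutureOriented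
  certifiedLate certifiedSlab HasExhaustiveCharts)
open Literature.Geometry.Lorentzian.InitialDataSet (IsTameDataFamily IsImmersedAtZero IsTameChristodoulouGeneric)
open Summit.FinalStateConjecture.FinalStateConjecture.Theses.LogTimeThreeAnnuli (SubconvergentEraGeneric)
open Summit.FinalStateConjecture.FinalStateConjecture.Theses.ExactKerrEnds (TameEscapeToKerrEnds CensorshipAlongKerrEnds)

/-- **A compact sub-extremal window around finitely many sub-extremal labels.**  For positive masses `Mᵢ` and spins
`|aᵢ| < Mᵢ`, `i` ranging over a finite type, there are `m₀ > 0` and `0 ≤ χ < 1` with `m₀ ≤ Mᵢ ≤ m₀⁻¹` and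
`|aᵢ| ≤ χ Mᵢ` for all `i`. [folklore] -/
theorem exists_window_of_isSubextremal {N : ℕ} (mass spin : Fin N → ℝ) (hpos : ∀ i, 0 < mass i)
    (hsub : ∀ i, Kerr.IsSubextremal (mass i) (spin i)) :
    ∃ m₀ χ : ℝ, 0 < m₀ ∧ 0 ≤ χ ∧ χ < 1 ∧ ∀ i, m₀ ≤ mass i ∧ mass i ≤ m₀⁻¹ ∧ |spin i| ≤ χ * mass i := by
  -- masses: `m₀ := (1 + Σⱼ (Mⱼ + Mⱼ⁻¹))⁻¹`
  set S : ℝ := ∑ j, (mass j + (mass j)⁻¹) with hS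
  have hSnn : 0 ≤ S := Finset.sum_nonneg fun j _ => by have := hpos j; positivity
  have hle : ∀ i, mass i + (mass i)⁻¹ ≤ S := fun i =>
    Finset.single_le_sum (f := fun j => mass j + (mass j)⁻¹) (fun j _ => by have := hpos j; positivity)
      (Finset.mem_univ i)
  -- spins: `χ := maxᵢ |aᵢ| / Mᵢ` (or `0` if there is no hole)
  obtain ⟨χ, hχ0, hχ1, hχ⟩ : ∃ χ : ℝ, 0 ≤ χ ∧ χ < 1 ∧ ∀ i, |spin i| ≤ χ * mass i := by
    cases isEmpty_or_nonempty (Fin N) with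
    | inl h => exact ⟨0, le_rfl, one_pos, fun i => isEmptyElim i⟩
    | inr h =>
      obtain ⟨i₀, hi₀⟩ := Finite.exists_max fun i => |spin i| / mass i
      refine ⟨|spin i₀| / mass i₀, by have := hpos i₀; positivity,
        (div_lt_one (hpos i₀)).2 (hsub i₀), fun i => ?_⟩
      have h := hi₀ i
      rwa [div_le_iff₀ (hpos i)] at h
  refine ⟨(1 + S)⁻¹, χ, by positivity, hχ0, hχ1, fun i => ⟨?_, ?_, hχ i⟩⟩
  · refine inv_le_of_inv_le₀ (hpos i) ?_
    have : (mass i)⁻¹ ≤ mass i + (mass i)⁻¹ := by linarith [hpos i]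
    linarith [hle i]
  · rw [inv_inv]
    have : mass i ≤ mass i + (mass i)⁻¹ := by have := hpos i; linarith [inv_pos.2 (hpos i)]
    linarith [hle i]

/-- **Settled in the Statement's vocabulary at all orders ⇒ the crux's honest subconvergent era (one development).**
Given a maximal-development carrier `𝒟`, a region `O` and a final state decomposition `d : FinalStateDecomposition 𝒟 O 2`
with sub-extremal holes, `O = exteriorOf charted`, `RaysStayInClosure O`, `IsFutureOriented d`, honest exhaustive radii
`Rᵢ` (`Rᵢ → ∞`, `Rᵢ ≥ max(r₊,0)+1`, causal exhaustion of `O` by the certified regions) and convergence in the SAME charts at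
EVERY order `k` on the flat slabs, the fixed near zones and the growing near zones, the era of
`LogTimeThreeAnnuli.SubconvergentEraGeneric` holds verbatim: `m₀, χ` from `exists_window_of_isSubextremal`, the quasi
decomposition `d.toQuasi` (same charts; `charted`, `certifiedLate`, `certifiedSlab` agree by `rfl`), the same radii, the
window member frozen at the label `(Mᵢ, aᵢ)` (its background IS `d.background i`), and the `(M,a)`-uniform covector
orientation from the vector one by the cone lemma at a `C⁰` tolerance `δ ‖Λᵢ‖² < 1`.  Order-by-order bookkeeping; no
analysis.  Klainerman 2025 §2.3 (asymptotic ⇒ orbital); O'Neill 1983 Ch. 5 Lemma 5.29. [cite: Klainerman2025, §2.3]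
[cite: ONeill1983, Ch. 5 Lemma 5.29] -/
theorem era_of_settledAllOrders {X : Type} [TopologicalSpace X] [ChartedSpace E3 X] [IsManifold (𝓡 3) ∞ X]
    [ConnectedSpace X] {D : InitialDataSet (𝓡 3) X} (𝒟 : VacuumCauchyDevelopment D) (O : Set 𝒟.carrier)
    (d : FinalStateDecomposition 𝒟.toSpacetime O 2) (hsub : ∀ i, Kerr.IsSubextremal (d.mass i) (d.spin i))
    (hO : O = exteriorOf 𝒟.toCauchyDevelopment d.charted) (hrays : RaysStayInClosure 𝒟.toCauchyDevelopment O)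
    (hor : IsFutureOriented d)
    (hflat : ∀ k, Tendsto (fun τ => 𝒟.toSpacetime.deviationCk (Minkowski.backgroundOn d.flatDomain) d.flatChart k τ)
      atTop (𝓝 0))
    (hnear : ∀ i k (ρ : ℝ), Tendsto (fun τ => 𝒟.toSpacetime.truncDeviationCk (d.background i) (d.chart i) k ρ τ)
      atTop (𝓝 0))
    (R : Fin d.N → ℝ → ℝ) (hR : ∀ i, Tendsto (R i) atTop atTop ∧ ∀ τ, max (Kerr.rPlus (d.mass i) (d.spin i)) 0 + 1 ≤ R i τ)
    (hgrow : ∀ i k, Tendsto (fun τ => 𝒟.toSpacetime.truncDeviationCk (d.background i) (d.chart i) k (R i τ) τ)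
      atTop (𝓝 0))
    (hexh : ∀ τ₁, d.τ₀ < τ₁ → O \ certifiedLate d R τ₁ ⊆ 𝒟.metric.causalPast 𝒟.timeOrientation (certifiedSlab d R τ₁)) :
    (∃ (m₀ χ : ℝ) (O : Set 𝒟.carrier) (d : QuasiFinalStateDecomposition 𝒟.toSpacetime O 2 ⊤) (R : Fin d.N → ℝ → ℝ), 0 < m₀ ∧ χ < 1 ∧ O = exteriorOf 𝒟.toCauchyDevelopment d.charted ∧ RaysStayInClosure 𝒟.toCauchyDevelopment O ∧ (∀ i, Tendsto (R i) atTop atTop ∧ ∀ τ, max (Kerr.rPlus (d.mass i) (d.spin i)) 0 + 1 ≤ R i τ) ∧ (∀ τ₁, d.τ₀ < τ₁ → O \ d.certifiedLate R τ₁ ⊆ 𝒟.metric.causalPast 𝒟.timeOrientation (d.certifiedSlab R τ₁)) ∧ (∀ i, IsOrthochronous (d.motion i).1) ∧ (∀ i (ρ : ℝ), ∀ᶠ τ in atTop, ∀ x ∈ (d.background i).truncTimeSlab ρ τ, ∀ w : E4, 𝒟.timeOrientation.IsFutureDirected (mfderiv 𝓘(ℝ, E4) (𝓡 4) (d.chart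 i) x w) → 0 < ((d.motion i).1 : E4 ≃L[ℝ] E4).symm w 0) ∧ (∀ᶠ τ in atTop, ∀ x ∈ (Minkowski.backgroundOn d.flatDomain).timeSlab τ, 𝒟.timeOrientation.IsFutureDirected (mfderiv 𝓘(ℝ, E4) (𝓡 4) d.flatChart x (E4.basisVector 0))) ∧ (∀ k, Tendsto (fun τ => 𝒟.toSpacetime.deviationCk (Minkowski.backgroundOn d.flatDomain) d.flatChart k τ) atTop (𝓝 0)) ∧ (∀ i k (ρ : ℝ) (ε : ℝ≥0∞), 0 < ε → ∀ᶠ τ in atTop, ∃ M a, m₀ ≤ M ∧ M ≤ m₀⁻¹ ∧ |a| ≤ χ * M ∧ 𝒟.toSpacetime.truncDeviationCk ⟨(d.background i).domain, boostedKerrBilin (d.motion i).1 (d.motion i).2 M a, (d.background i).time, (d.background i).radius⟩ (d.chart i) k ρ τ ≤ ε ∧ 𝒟.toSpacetime.truncDeviationCk ⟨(d.background i).domain, boostedKerrBilin (d.motion i).1 (d.motion i).2 M a, (d.background i).time, (d.background i).radius⟩ (d.chart i) k (R i τ) τ ≤ ε)) := by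
  obtain ⟨m₀, χ, hm₀, -, hχ1, hwin⟩ := exists_window_of_isSubextremal d.mass d.spin d.mass_pos hsub
  refine ⟨m₀, χ, O, d.toQuasi (by simp), R, hm₀, hχ1, hO, hrays, hR, hexh, hor.1, fun i ρ => ?_, hor.2.2, hflat,
    fun i k ρ ε hε => ?_⟩
  · -- covector orientation on `{t*ᵢ = τ, rᵢ ≤ ρ}` from the vector one at `C⁰` tolerance `δ ‖Λᵢ‖² < 1`
    obtain ⟨δ, hδpos, hδΛ⟩ : ∃ δ : ℝ, 0 < δ ∧
        δ * ‖(((d.motion i).1 : E4 ≃L[ℝ] E4) : E4 →L[ℝ] E4)‖ ^ 2 < 1 :=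
      ⟨1 / (‖(((d.motion i).1 : E4 ≃L[ℝ] E4) : E4 →L[ℝ] E4)‖ ^ 2 + 1), by positivity, by
        rw [div_mul_eq_mul_div, one_mul, div_lt_one (by positivity)]
        linarith⟩
    filter_upwards [hor.2.1 i ρ, (hnear i 0 ρ).eventually (ge_mem_nhds (ENNReal.ofReal_pos.mpr hδpos))]
      with τ hV hdev
    intro x hx w hw
    exact symm_apply_zero_pos_of_isFutureDirected (d.background i)
      (boostedKerrBilin (d.motion i).1 (d.motion i).2 (d.mass i) (d.spin i)) (d.chart i) (d.motion i).1
      (d.motion i).2 (d.mass_pos i).le hδpos hδΛ hdev hx (fun v w => boostedKerrBilin_apply _ _ _ _ _ _ _)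
      (hV x hx) hw
  · -- windowed closeness: freeze the member at the label `(Mᵢ, aᵢ)`; its background is `d.background i`
    filter_upwards [(hnear i k ρ).eventually (ge_mem_nhds hε), (hgrow i k).eventually (ge_mem_nhds hε)]
      with τ h₁ h₂
    exact ⟨d.mass i, d.spin i, (hwin i).1, (hwin i).2.1, (hwin i).2.2, h₁, h₂⟩

/-- **Sanity: settled at all orders ⇒ the Statement's settled clause** (one development): keep the decomposition, read
`HasExhaustiveCharts` off the radii at order `2`.  [folklore] -/
theorem settled_of_settledAllOrders {X : Type} [TopologicalSpace X] [ChartedSpace E3 X] [IsManifold (𝓡 3) ∞ X]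
    [ConnectedSpace X] {D : InitialDataSet (𝓡 3) X} (𝒟 : VacuumCauchyDevelopment D) (O : Set 𝒟.carrier)
    (d : FinalStateDecomposition 𝒟.toSpacetime O 2) (hsub : ∀ i, Kerr.IsSubextremal (d.mass i) (d.spin i))
    (hO : O = exteriorOf 𝒟.toCauchyDevelopment d.charted) (hrays : RaysStayInClosure 𝒟.toCauchyDevelopment O)
    (hor : IsFutureOriented d)
    (R : Fin d.N → ℝ → ℝ) (hR : ∀ i, Tendsto (R i) atTop atTop ∧ ∀ τ, max (Kerr.rPlus (d.mass i) (d.spin i)) 0 + 1 ≤ R i τ)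
    (hgrow : ∀ i k, Tendsto (fun τ => 𝒟.toSpacetime.truncDeviationCk (d.background i) (d.chart i) k (R i τ) τ)
      atTop (𝓝 0))
    (hexh : ∀ τ₁, d.τ₀ < τ₁ → O \ certifiedLate d R τ₁ ⊆ 𝒟.metric.causalPast 𝒟.timeOrientation (certifiedSlab d R τ₁)) :
    ∃ (O : Set 𝒟.carrier) (d : FinalStateDecomposition 𝒟.toSpacetime O 2),
      (∀ i, Kerr.IsSubextremal (d.mass i) (d.spin i)) ∧ O = exteriorOf 𝒟.toCauchyDevelopment d.charted ∧
        RaysStayInClosure 𝒟.toCauchyDevelopment O ∧ HasExhaustiveCharts d ∧ IsFutureOriented d :=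
  ⟨O, d, hsub, hO, hrays, ⟨R, hR, fun i => hgrow i 2, hexh⟩, hor⟩

/-- **Settled at all orders ⇒ the crux's property, per datum**: every maximal development with complete `𝓘⁺` and the
all-orders settled clause carries the crux's era (`era_of_settledAllOrders`). [folklore] -/
theorem subconvergentEra_of_settledAllOrders {X : Type} [TopologicalSpace X] [ChartedSpace E3 X] [IsManifold (𝓡 3) ∞ X]
    [ConnectedSpace X] {D : InitialDataSet (𝓡 3) X}
    (h : ∀ 𝒟 : VacuumCauchyDevelopment D, 𝒟.IsMaximal → HasCompleteNullInfinity 𝒟.toCauchyDevelopment ∧ ∃ (O : Set 𝒟.carrier) (d : FinalStateDecomposition 𝒟.toSpacetime O 2), (∀ i, Kerr.IsSubextremal (d.mass i) (d.spin i)) ∧ O = exteriorOf 𝒟.toCauchyDevelopment d.charted ∧ RaysStayInClosure 𝒟.toCauchyDevelopment O ∧ IsFutureOriented d ∧ (∀ k, Tendsto (fun τ => 𝒟.toSpacetime.deviationCk (Minkowski.backgroundOn d.flatDomain) d.flatChart k τ) atTop (𝓝 0)) ∧ (∀ i k (ρ : ℝ), Tendsto (fun τ => 𝒟.toSpacetime.truncDeviationCk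 (d.background i) (d.chart i) k ρ τ) atTop (𝓝 0)) ∧ ∃ R : Fin d.N → ℝ → ℝ, (∀ i, Tendsto (R i) atTop atTop ∧ ∀ τ, max (Kerr.rPlus (d.mass i) (d.spin i)) 0 + 1 ≤ R i τ) ∧ (∀ i k, Tendsto (fun τ => 𝒟.toSpacetime.truncDeviationCk (d.background i) (d.chart i) k (R i τ) τ) atTop (𝓝 0)) ∧ ∀ τ₁, d.τ₀ < τ₁ → O \ certifiedLate d R τ₁ ⊆ 𝒟.metric.causalPast 𝒟.timeOrientation (certifiedSlab d R τ₁)) :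
    ∀ 𝒟 : VacuumCauchyDevelopment D, 𝒟.IsMaximal → HasCompleteNullInfinity 𝒟.toCauchyDevelopment ∧ (∃ (m₀ χ : ℝ) (O : Set 𝒟.carrier) (d : QuasiFinalStateDecomposition 𝒟.toSpacetime O 2 ⊤) (R : Fin d.N → ℝ → ℝ), 0 < m₀ ∧ χ < 1 ∧ O = exteriorOf 𝒟.toCauchyDevelopment d.charted ∧ RaysStayInClosure 𝒟.toCauchyDevelopment O ∧ (∀ i, Tendsto (R i) atTop atTop ∧ ∀ τ, max (Kerr.rPlus (d.mass i) (d.spin i)) 0 + 1 ≤ R i τ) ∧ (∀ τ₁, d.τ₀ < τ₁ → O \ d.certifiedLate R τ₁ ⊆ 𝒟.metric.causalPast 𝒟.timeOrientation (d.certifiedSlab R τ₁)) ∧ (∀ i, IsOrthochronous (d.motion i).1) ∧ (∀ i (ρ : ℝ), ∀ᶠ τ in atTop, ∀ x ∈ (d.background i).truncTimeSlab ρ τ, ∀ w : E4, 𝒟.timeOrientation.IsFutureDirected (mfderiv 𝓘(ℝ, E4) (𝓡 4) (d.chart i) x w) → 0 < ((d.motion i).1 : E4 ≃L[ℝ] E4).symm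 w 0) ∧ (∀ᶠ τ in atTop, ∀ x ∈ (Minkowski.backgroundOn d.flatDomain).timeSlab τ, 𝒟.timeOrientation.IsFutureDirected (mfderiv 𝓘(ℝ, E4) (𝓡 4) d.flatChart x (E4.basisVector 0))) ∧ (∀ k, Tendsto (fun τ => 𝒟.toSpacetime.deviationCk (Minkowski.backgroundOn d.flatDomain) d.flatChart k τ) atTop (𝓝 0)) ∧ (∀ i k (ρ : ℝ) (ε : ℝ≥0∞), 0 < ε → ∀ᶠ τ in atTop, ∃ M a, m₀ ≤ M ∧ M ≤ m₀⁻¹ ∧ |a| ≤ χ * M ∧ 𝒟.toSpacetime.truncDeviationCk ⟨(d.background i).domain, boostedKerrBilin (d.motion i).1 (d.motion i).2 M a, (d.background i).time, (d.background i).radius⟩ (d.chart i) k ρ τ ≤ ε ∧ 𝒟.toSpacetime.truncDeviationCk ⟨(d.background i).domain, boostedKerrBilin (d.motion i).1 (d.motion i).2 M a, (d.background i).time, (d.background i).radius⟩ (d.chart i) k (R i τ) τ ≤ ε)) := by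
  intro 𝒟 hmax
  obtain ⟨hscri, O, d, hsub, hO, hrays, hor, hflat, hnear, R, hR, hgrow, hexh⟩ := h 𝒟 hmax
  exact ⟨hscri, era_of_settledAllOrders 𝒟 O d hsub hO hrays hor hflat hnear R hR hgrow hexh⟩

/-- **C₂^∞ → C₂'.**  C₂' = the registered residual stub `stub_subconvergentEraAlongCensoredKerrEnds` of the skeleton of
stmt-17490 (inlined; crux-equivalent modulo E, C₁ by p154553); C₂^∞ = ALL-ORDERS SETTLING ALONG CENSORED KERR-ENDED CURVES
through exceptional base data (inlined): along every tame curve of admissible data, immersed-injective or constant, whose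
members off `0` are Kerr-ended (`InitialDataSet.HasExactKerrEnd`) and censored and whose base datum is NOT settled at all
orders, passes a tame injective immersed admissible curve through the same base datum whose members off `0` are settled at
all orders (every MGHD: complete `𝓘⁺`, a `C²` final state decomposition of `O = exteriorOf charted` with sub-extremal
holes, `RaysStayInClosure`, `IsFutureOriented`, honest exhaustive radii, and convergence in the same charts at every order
on flat slabs, fixed and growing near zones).  Proof: the base datum exceptional for the crux's property is exceptional for
all-orders settling (`subconvergentEra_of_settledAllOrders`, contrapositive), and the members handed back are mapped
through `subconvergentEra_of_settledAllOrders`.  [folklore] -/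
theorem alongCensoredKerrEnds_of_settlingAllOrdersAlongCensoredKerrEnds :
    (∀ (X : Type) [TopologicalSpace X] [ChartedSpace E3 X] [IsManifold (𝓡 3) ∞ X] [T2Space X] [SecondCountableTopology X] [ConnectedSpace X], ∀ (e : AFEnd X) (F : EuclideanSpace ℝ (Fin 1) → InitialDataSet (𝓡 3) X), IsTameDataFamily e 1 F → ((IsImmersedAtZero 1 F ∧ Injective F) ∨ ∀ c, F c = F 0) → (∀ c, F c ∈ admissibleVacuumData X) → (∀ c ≠ 0, (F c).HasExactKerrEnd ∧ ∀ 𝒟 : VacuumCauchyDevelopment (F c), 𝒟.IsMaximal → HasCompleteNullInfinity 𝒟.toCauchyDevelopment) → ¬ (∀ 𝒟 : VacuumCauchyDevelopment (F 0), 𝒟.IsMaximal → HasCompleteNullInfinity 𝒟.toCauchyDevelopment ∧ ∃ (O : Set 𝒟.carrier) (d : FinalStateDecomposition 𝒟.toSpacetime O 2), (∀ i, Kerr.IsSubextremal (d.mass i) (d.spin i)) ∧ O = exteriorOf 𝒟.toCauchyDevelopment d.charted ∧ RaysStayInClosure 𝒟.toCauchyDevelopment O ∧ IsFutureOriented d ∧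 (∀ k, Tendsto (fun τ => 𝒟.toSpacetime.deviationCk (Minkowski.backgroundOn d.flatDomain) d.flatChart k τ) atTop (𝓝 0)) ∧ (∀ i k (ρ : ℝ), Tendsto (fun τ => 𝒟.toSpacetime.truncDeviationCk (d.background i) (d.chart i) k ρ τ) atTop (𝓝 0)) ∧ ∃ R : Fin d.N → ℝ → ℝ, (∀ i, Tendsto (R i) atTop atTop ∧ ∀ τ, max (Kerr.rPlus (d.mass i) (d.spin i)) 0 + 1 ≤ R i τ) ∧ (∀ i k, Tendsto (fun τ => 𝒟.toSpacetime.truncDeviationCk (d.background i) (d.chart i) k (R i τ) τ) atTop (𝓝 0)) ∧ ∀ τ₁, d.τ₀ < τ₁ → O \ certifiedLate d R τ₁ ⊆ 𝒟.metric.causalPast 𝒟.timeOrientation (certifiedSlab d R τ₁)) → ∃ (e' : AFEnd X) (F' : EuclideanSpace ℝ (Fin 1) → InitialDataSet (𝓡 3) X), IsTameDataFamily e' 1 F' ∧ F' 0 = F 0 ∧ Injective F' ∧ IsImmersedAtZero 1 F' ∧ (∀ c, F' c ∈ admissibleVacuumData X) ∧ ∀ c ≠ 0, ∀ 𝒟 :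 VacuumCauchyDevelopment (F' c), 𝒟.IsMaximal → HasCompleteNullInfinity 𝒟.toCauchyDevelopment ∧ ∃ (O : Set 𝒟.carrier) (d : FinalStateDecomposition 𝒟.toSpacetime O 2), (∀ i, Kerr.IsSubextremal (d.mass i) (d.spin i)) ∧ O = exteriorOf 𝒟.toCauchyDevelopment d.charted ∧ RaysStayInClosure 𝒟.toCauchyDevelopment O ∧ IsFutureOriented d ∧ (∀ k, Tendsto (fun τ => 𝒟.toSpacetime.deviationCk (Minkowski.backgroundOn d.flatDomain) d.flatChart k τ) atTop (𝓝 0)) ∧ (∀ i k (ρ : ℝ), Tendsto (fun τ => 𝒟.toSpacetime.truncDeviationCk (d.background i) (d.chart i) k ρ τ) atTop (𝓝 0)) ∧ ∃ R : Fin d.N → ℝ → ℝ, (∀ i, Tendsto (R i) atTop atTop ∧ ∀ τ, max (Kerr.rPlus (d.mass i) (d.spin i)) 0 + 1 ≤ R i τ) ∧ (∀ i k, Tendsto (fun τ => 𝒟.toSpacetime.truncDeviationCk (d.background i) (d.chart i) k (R i τ) τ) atTop (𝓝 0)) ∧ ∀ τ₁, d.τ₀ < τ₁ → O \ certifiedLate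 d R τ₁ ⊆ 𝒟.metric.causalPast 𝒟.timeOrientation (certifiedSlab d R τ₁)) →
    (∀ (X : Type) [TopologicalSpace X] [ChartedSpace E3 X] [IsManifold (𝓡 3) ∞ X] [T2Space X] [SecondCountableTopology X] [ConnectedSpace X], ∀ (e : AFEnd X) (F : EuclideanSpace ℝ (Fin 1) → InitialDataSet (𝓡 3) X), IsTameDataFamily e 1 F → ((IsImmersedAtZero 1 F ∧ Injective F) ∨ ∀ c, F c = F 0) → (∀ c, F c ∈ admissibleVacuumData X) → (∀ c ≠ 0, (F c).HasExactKerrEnd ∧ ∀ 𝒟 : VacuumCauchyDevelopment (F c), 𝒟.IsMaximal → HasCompleteNullInfinity 𝒟.toCauchyDevelopment) → ¬ (∀ 𝒟 : VacuumCauchyDevelopment (F 0), 𝒟.IsMaximal → HasCompleteNullInfinity 𝒟.toCauchyDevelopment ∧ (∃ (m₀ χ : ℝ) (O : Set 𝒟.carrier) (d : QuasiFinalStateDecomposition 𝒟.toSpacetime O 2 ⊤) (R : Fin d.N → ℝ → ℝ), 0 < m₀ ∧ χ < 1 ∧ O = exteriorOf 𝒟.toCauchyDevelopment d.charted ∧ RaysStayInClosure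 𝒟.toCauchyDevelopment O ∧ (∀ i, Tendsto (R i) atTop atTop ∧ ∀ τ, max (Kerr.rPlus (d.mass i) (d.spin i)) 0 + 1 ≤ R i τ) ∧ (∀ τ₁, d.τ₀ < τ₁ → O \ d.certifiedLate R τ₁ ⊆ 𝒟.metric.causalPast 𝒟.timeOrientation (d.certifiedSlab R τ₁)) ∧ (∀ i, IsOrthochronous (d.motion i).1) ∧ (∀ i (ρ : ℝ), ∀ᶠ τ in atTop, ∀ x ∈ (d.background i).truncTimeSlab ρ τ, ∀ w : E4, 𝒟.timeOrientation.IsFutureDirected (mfderiv 𝓘(ℝ, E4) (𝓡 4) (d.chart i) x w) → 0 < ((d.motion i).1 : E4 ≃L[ℝ] E4).symm w 0) ∧ (∀ᶠ τ in atTop, ∀ x ∈ (Minkowski.backgroundOn d.flatDomain).timeSlab τ, 𝒟.timeOrientation.IsFutureDirected (mfderiv 𝓘(ℝ, E4) (𝓡 4) d.flatChart x (E4.basisVector 0))) ∧ (∀ k, Tendsto (fun τ => 𝒟.toSpacetime.deviationCk (Minkowski.backgroundOn d.flatDomain) d.flatChart k τ) atTop (𝓝 0)) ∧ (∀ i k (ρ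 : ℝ) (ε : ℝ≥0∞), 0 < ε → ∀ᶠ τ in atTop, ∃ M a, m₀ ≤ M ∧ M ≤ m₀⁻¹ ∧ |a| ≤ χ * M ∧ 𝒟.toSpacetime.truncDeviationCk ⟨(d.background i).domain, boostedKerrBilin (d.motion i).1 (d.motion i).2 M a, (d.background i).time, (d.background i).radius⟩ (d.chart i) k ρ τ ≤ ε ∧ 𝒟.toSpacetime.truncDeviationCk ⟨(d.background i).domain, boostedKerrBilin (d.motion i).1 (d.motion i).2 M a, (d.background i).time, (d.background i).radius⟩ (d.chart i) k (R i τ) τ ≤ ε))) → ∃ (e' : AFEnd X) (F' : EuclideanSpace ℝ (Fin 1) → InitialDataSet (𝓡 3) X), IsTameDataFamily e' 1 F' ∧ F' 0 = F 0 ∧ Injective F' ∧ IsImmersedAtZero 1 F' ∧ (∀ c, F' c ∈ admissibleVacuumData X) ∧ ∀ c ≠ 0, ∀ 𝒟 : VacuumCauchyDevelopment (F' c), 𝒟.IsMaximal → HasCompleteNullInfinity 𝒟.toCauchyDevelopment ∧ (∃ (m₀ χ : ℝ) (O : Set 𝒟.carrier) (d : QuasiFinalStateDecomposition 𝒟.toSpacetime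 O 2 ⊤) (R : Fin d.N → ℝ → ℝ), 0 < m₀ ∧ χ < 1 ∧ O = exteriorOf 𝒟.toCauchyDevelopment d.charted ∧ RaysStayInClosure 𝒟.toCauchyDevelopment O ∧ (∀ i, Tendsto (R i) atTop atTop ∧ ∀ τ, max (Kerr.rPlus (d.mass i) (d.spin i)) 0 + 1 ≤ R i τ) ∧ (∀ τ₁, d.τ₀ < τ₁ → O \ d.certifiedLate R τ₁ ⊆ 𝒟.metric.causalPast 𝒟.timeOrientation (d.certifiedSlab R τ₁)) ∧ (∀ i, IsOrthochronous (d.motion i).1) ∧ (∀ i (ρ : ℝ), ∀ᶠ τ in atTop, ∀ x ∈ (d.background i).truncTimeSlab ρ τ, ∀ w : E4, 𝒟.timeOrientation.IsFutureDirected (mfderiv 𝓘(ℝ, E4) (𝓡 4) (d.chart i) x w) → 0 < ((d.motion i).1 : E4 ≃L[ℝ] E4).symm w 0) ∧ (∀ᶠ τ in atTop, ∀ x ∈ (Minkowski.backgroundOn d.flatDomain).timeSlab τ, 𝒟.timeOrientation.IsFutureDirected (mfderiv 𝓘(ℝ, E4) (𝓡 4) d.flatChart x (E4.basisVector 0)))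 ∧ (∀ k, Tendsto (fun τ => 𝒟.toSpacetime.deviationCk (Minkowski.backgroundOn d.flatDomain) d.flatChart k τ) atTop (𝓝 0)) ∧ (∀ i k (ρ : ℝ) (ε : ℝ≥0∞), 0 < ε → ∀ᶠ τ in atTop, ∃ M a, m₀ ≤ M ∧ M ≤ m₀⁻¹ ∧ |a| ≤ χ * M ∧ 𝒟.toSpacetime.truncDeviationCk ⟨(d.background i).domain, boostedKerrBilin (d.motion i).1 (d.motion i).2 M a, (d.background i).time, (d.background i).radius⟩ (d.chart i) k ρ τ ≤ ε ∧ 𝒟.toSpacetime.truncDeviationCk ⟨(d.background i).domain, boostedKerrBilin (d.motion i).1 (d.motion i).2 M a, (d.background i).time, (d.background i).radius⟩ (d.chart i) k (R i τ) τ ≤ ε))) := by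
  intro h X _ _ _ _ _ _ e F hF hdich hadm hQ hexc
  obtain ⟨e', F', hF', h0, hinj, himm, hadm', hS⟩ :=
    h X e F hF hdich hadm hQ fun hsettled => hexc (subconvergentEra_of_settledAllOrders hsettled)
  exact ⟨e', F', hF', h0, hinj, himm, hadm', fun c hc => subconvergentEra_of_settledAllOrders (hS c hc)⟩

/-- **The crux from E (stmt-18522), C₁ (stmt-18521) and all-orders settling along censored Kerr-ended curves (C₂^∞).**
`subconvergentEraGeneric_of_alongCensoredKerrEnds` (p154553) after `C₂^∞ → C₂'`.  Conclusion: the route decl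
`Theses.LogTimeThreeAnnuli.SubconvergentEraGeneric`, by name.  Christodoulou, CQG 16 (1999) A23, p. A24.
[cite: Christodoulou1999, p. A24] -/
theorem subconvergentEraGeneric_of_settlingAllOrdersAlongCensoredKerrEnds : TameEscapeToKerrEnds → CensorshipAlongKerrEnds → (∀ (X : Type) [TopologicalSpace X] [ChartedSpace E3 X] [IsManifold (𝓡 3) ∞ X] [T2Space X] [SecondCountableTopology X] [ConnectedSpace X], ∀ (e : AFEnd X) (F : EuclideanSpace ℝ (Fin 1) → InitialDataSet (𝓡 3) X), IsTameDataFamily e 1 F → ((IsImmersedAtZero 1 F ∧ Injective F) ∨ ∀ c, F c = F 0) → (∀ c, F c ∈ admissibleVacuumData X) → (∀ c ≠ 0, (F c).HasExactKerrEnd ∧ ∀ 𝒟 : VacuumCauchyDevelopment (F c), 𝒟.IsMaximal → HasCompleteNullInfinity 𝒟.toCauchyDevelopment) → ¬ (∀ 𝒟 : VacuumCauchyDevelopment (F 0), 𝒟.IsMaximal → HasCompleteNullInfinity 𝒟.toCauchyDevelopment ∧ ∃ (O : Set 𝒟.carrier) (d : FinalStateDecomposition 𝒟.toSpacetime O 2),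 (∀ i, Kerr.IsSubextremal (d.mass i) (d.spin i)) ∧ O = exteriorOf 𝒟.toCauchyDevelopment d.charted ∧ RaysStayInClosure 𝒟.toCauchyDevelopment O ∧ IsFutureOriented d ∧ (∀ k, Tendsto (fun τ => 𝒟.toSpacetime.deviationCk (Minkowski.backgroundOn d.flatDomain) d.flatChart k τ) atTop (𝓝 0)) ∧ (∀ i k (ρ : ℝ), Tendsto (fun τ => 𝒟.toSpacetime.truncDeviationCk (d.background i) (d.chart i) k ρ τ) atTop (𝓝 0)) ∧ ∃ R : Fin d.N → ℝ → ℝ, (∀ i, Tendsto (R i) atTop atTop ∧ ∀ τ, max (Kerr.rPlus (d.mass i) (d.spin i)) 0 + 1 ≤ R i τ) ∧ (∀ i k, Tendsto (fun τ => 𝒟.toSpacetime.truncDeviationCk (d.background i) (d.chart i) k (R i τ) τ) atTop (𝓝 0)) ∧ ∀ τ₁, d.τ₀ < τ₁ → O \ certifiedLate d R τ₁ ⊆ 𝒟.metric.causalPast 𝒟.timeOrientation (certifiedSlab d R τ₁)) → ∃ (e' : AFEnd X) (F' : EuclideanSpace ℝ (Fin 1) → InitialDataSet (𝓡 3) X),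 IsTameDataFamily e' 1 F' ∧ F' 0 = F 0 ∧ Injective F' ∧ IsImmersedAtZero 1 F' ∧ (∀ c, F' c ∈ admissibleVacuumData X) ∧ ∀ c ≠ 0, ∀ 𝒟 : VacuumCauchyDevelopment (F' c), 𝒟.IsMaximal → HasCompleteNullInfinity 𝒟.toCauchyDevelopment ∧ ∃ (O : Set 𝒟.carrier) (d : FinalStateDecomposition 𝒟.toSpacetime O 2), (∀ i, Kerr.IsSubextremal (d.mass i) (d.spin i)) ∧ O = exteriorOf 𝒟.toCauchyDevelopment d.charted ∧ RaysStayInClosure 𝒟.toCauchyDevelopment O ∧ IsFutureOriented d ∧ (∀ k, Tendsto (fun τ => 𝒟.toSpacetime.deviationCk (Minkowski.backgroundOn d.flatDomain) d.flatChart k τ) atTop (𝓝 0)) ∧ (∀ i k (ρ : ℝ), Tendsto (fun τ => 𝒟.toSpacetime.truncDeviationCk (d.background i) (d.chart i) k ρ τ) atTop (𝓝 0)) ∧ ∃ R : Fin d.N → ℝ → ℝ, (∀ i, Tendsto (R i) atTop atTop ∧ ∀ τ, max (Kerr.rPlus (d.mass i) (d.spin i)) 0 + 1 ≤ R i τ)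 ∧ (∀ i k, Tendsto (fun τ => 𝒟.toSpacetime.truncDeviationCk (d.background i) (d.chart i) k (R i τ) τ) atTop (𝓝 0)) ∧ ∀ τ₁, d.τ₀ < τ₁ → O \ certifiedLate d R τ₁ ⊆ 𝒟.metric.causalPast 𝒟.timeOrientation (certifiedSlab d R τ₁)) → SubconvergentEraGeneric :=
  fun hE hC h => subconvergentEraGeneric_of_alongCensoredKerrEnds hE hC
    (alongCensoredKerrEnds_of_settlingAllOrdersAlongCensoredKerrEnds h)


/-- **Settled in the Statement's vocabulary AT ORDER `k₀ ≥ 2` ⇒ the crux's era UP TO ORDER `k₀` (one development).**  The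
finite-order form of `era_of_settledAllOrders`, with hypotheses EXACTLY the Statement's settled clause at index `k₀` (a
`FinalStateDecomposition 𝒟 O k₀` with sub-extremal holes, `O = exteriorOf charted`, `RaysStayInClosure`,
`Summit.FinalStateConjecture.HasExhaustiveCharts`, `Summit.FinalStateConjecture.IsFutureOriented` — for `k₀ = 2` verbatim the
conclusion of `FinalStateConjecture` / of `Theses.ExactKerrEnds.SettlingAlongCensoredKerrEnds` for that development) and conclusion
the era of `LogTimeThreeAnnuli.SubconvergentEraGeneric` with its two `∀ k` convergence clauses restricted to `k ≤ k₀` (all other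
clauses verbatim; quasi decomposition `(d.toQuasi _).ofLE`, same charts and radii; lower orders by monotonicity of the `Cᵏ` sup
norms).  This is the kernel-checked content of the finite-order repair `C′(K₀)` proposed by the crux's vetting refuter and lead c2:
at `K₀ = k₀` the import of such a restated crux is the Statement-vocabulary settled clause at index `k₀`, which for `k₀ = 2` EXISTS
in the tree (stmt-FinalStateConjecture-18520 along censored Kerr ends; the summit itself pointwise).  Klainerman 2025 §2.3;
O'Neill 1983 Ch. 5 Lemma 5.29. [cite: Klainerman2025, §2.3] [cite: ONeill1983, Ch. 5 Lemma 5.29] -/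
theorem era_upTo_of_settled {X : Type} [TopologicalSpace X] [ChartedSpace E3 X] [IsManifold (𝓡 3) ∞ X]
    [ConnectedSpace X] {D : InitialDataSet (𝓡 3) X} (𝒟 : VacuumCauchyDevelopment D) (O : Set 𝒟.carrier) {k₀ : ℕ}
    (hk : 2 ≤ k₀) (d : FinalStateDecomposition 𝒟.toSpacetime O k₀) (hsub : ∀ i, Kerr.IsSubextremal (d.mass i) (d.spin i))
    (hO : O = exteriorOf 𝒟.toCauchyDevelopment d.charted) (hrays : RaysStayInClosure 𝒟.toCauchyDevelopment O)
    (hexh : HasExhaustiveCharts d) (hor : IsFutureOriented d) :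
    (∃ (m₀ χ : ℝ) (O : Set 𝒟.carrier) (d : QuasiFinalStateDecomposition 𝒟.toSpacetime O 2 ⊤) (R : Fin d.N → ℝ → ℝ), 0 < m₀ ∧ χ < 1 ∧ O = exteriorOf 𝒟.toCauchyDevelopment d.charted ∧ RaysStayInClosure 𝒟.toCauchyDevelopment O ∧ (∀ i, Tendsto (R i) atTop atTop ∧ ∀ τ, max (Kerr.rPlus (d.mass i) (d.spin i)) 0 + 1 ≤ R i τ) ∧ (∀ τ₁, d.τ₀ < τ₁ → O \ d.certifiedLate R τ₁ ⊆ 𝒟.metric.causalPast 𝒟.timeOrientation (d.certifiedSlab R τ₁)) ∧ (∀ i, IsOrthochronous (d.motion i).1) ∧ (∀ i (ρ : ℝ), ∀ᶠ τ in atTop, ∀ x ∈ (d.background i).truncTimeSlab ρ τ, ∀ w : E4, 𝒟.timeOrientation.IsFutureDirected (mfderiv 𝓘(ℝ, E4) (𝓡 4) (d.chart i) x w) → 0 < ((d.motion i).1 : E4 ≃L[ℝ] E4).symm w 0) ∧ (∀ᶠ τ in atTop, ∀ x ∈ (Minkowski.backgroundOn d.flatDomain).timeSlab τ, 𝒟.timeOrientation.IsFutureDirected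 (mfderiv 𝓘(ℝ, E4) (𝓡 4) d.flatChart x (E4.basisVector 0))) ∧ (∀ k ≤ k₀, Tendsto (fun τ => 𝒟.toSpacetime.deviationCk (Minkowski.backgroundOn d.flatDomain) d.flatChart k τ) atTop (𝓝 0)) ∧ (∀ i, ∀ k ≤ k₀, ∀ (ρ : ℝ) (ε : ℝ≥0∞), 0 < ε → ∀ᶠ τ in atTop, ∃ M a, m₀ ≤ M ∧ M ≤ m₀⁻¹ ∧ |a| ≤ χ * M ∧ 𝒟.toSpacetime.truncDeviationCk ⟨(d.background i).domain, boostedKerrBilin (d.motion i).1 (d.motion i).2 M a, (d.background i).time, (d.background i).radius⟩ (d.chart i) k ρ τ ≤ ε ∧ 𝒟.toSpacetime.truncDeviationCk ⟨(d.background i).domain, boostedKerrBilin (d.motion i).1 (d.motion i).2 M a, (d.background i).time, (d.background i).radius⟩ (d.chart i) k (R i τ) τ ≤ ε)) := by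
  obtain ⟨R, hR, hgrow, hcov⟩ := hexh
  obtain ⟨m₀, χ, hm₀, -, hχ1, hwin⟩ := exists_window_of_isSubextremal d.mass d.spin d.mass_pos hsub
  -- convergence at order `k ≤ k₀` in the same charts, by monotonicity of the `Cᵏ` sup norms
  have hnear : ∀ i, ∀ k ≤ k₀, ∀ ρ : ℝ,
      Tendsto (fun τ => 𝒟.toSpacetime.truncDeviationCk (d.background i) (d.chart i) k ρ τ) atTop (𝓝 0) :=
    fun i k hk' ρ => tendsto_of_tendsto_of_tendsto_of_le_of_le tendsto_const_nhds (d.tendsto_truncDeviationCk i ρ)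
      (fun _ => zero_le) fun _ => supCkENorm_mono_right _ hk' _
  have hgrow' : ∀ i, ∀ k ≤ k₀,
      Tendsto (fun τ => 𝒟.toSpacetime.truncDeviationCk (d.background i) (d.chart i) k (R i τ) τ) atTop (𝓝 0) :=
    fun i k hk' => tendsto_of_tendsto_of_tendsto_of_le_of_le tendsto_const_nhds (hgrow i)
      (fun _ => zero_le) fun _ => supCkENorm_mono_right _ hk' _
  have hflat : ∀ k ≤ k₀,
      Tendsto (fun τ => 𝒟.toSpacetime.deviationCk (Minkowski.backgroundOn d.flatDomain) d.flatChart k τ) atTop (𝓝 0) :=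
    fun k hk' => tendsto_of_tendsto_of_tendsto_of_le_of_le tendsto_const_nhds d.tendsto_deviationCk_flat
      (fun _ => zero_le) fun τ => 𝒟.toSpacetime.deviationCk_mono _ _ hk' τ
  refine ⟨m₀, χ, O, (d.toQuasi (by simp)).ofLE hk, R, hm₀, hχ1, hO, hrays, hR, hcov, hor.1, fun i ρ => ?_, hor.2.2, hflat,
    fun i k hk' ρ ε hε => ?_⟩
  · -- covector orientation from the vector one at `C⁰` tolerance `δ ‖Λᵢ‖² < 1` (order `0 ≤ k₀`)
    obtain ⟨δ, hδpos, hδΛ⟩ : ∃ δ : ℝ, 0 < δ ∧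
        δ * ‖(((d.motion i).1 : E4 ≃L[ℝ] E4) : E4 →L[ℝ] E4)‖ ^ 2 < 1 :=
      ⟨1 / (‖(((d.motion i).1 : E4 ≃L[ℝ] E4) : E4 →L[ℝ] E4)‖ ^ 2 + 1), by positivity, by
        rw [div_mul_eq_mul_div, one_mul, div_lt_one (by positivity)]
        linarith⟩
    filter_upwards [hor.2.1 i ρ,
      (hnear i 0 (Nat.zero_le _) ρ).eventually (ge_mem_nhds (ENNReal.ofReal_pos.mpr hδpos))] with τ hV hdev
    intro x hx w hw
    exact symm_apply_zero_pos_of_isFutureDirected (d.background i)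
      (boostedKerrBilin (d.motion i).1 (d.motion i).2 (d.mass i) (d.spin i)) (d.chart i) (d.motion i).1
      (d.motion i).2 (d.mass_pos i).le hδpos hδΛ hdev hx (fun v w => boostedKerrBilin_apply _ _ _ _ _ _ _)
      (hV x hx) hw
  · -- windowed closeness at order `k ≤ k₀`: freeze the member at the label
    filter_upwards [(hnear i k hk' ρ).eventually (ge_mem_nhds hε), (hgrow' i k hk').eventually (ge_mem_nhds hε)]
      with τ h₁ h₂
    exact ⟨d.mass i, d.spin i, (hwin i).1, (hwin i).2.1, (hwin i).2.2, h₁, h₂⟩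


/-- **A deciding theorem for the MERGED seam: E, C₁, all-orders settling along censored Kerr ends and MGHD existence give the
summit.**  `TameEscapeToKerrEnds → CensorshipAlongKerrEnds → C₂^∞ → MGHDExists → FinalStateConjecture`: the `ExactKerrEnds`
assembly (`isTameChristodoulouGeneric_of_relative'` for E, C₁; `isTameChristodoulouGeneric_of_relative_exceptional` for the
settling hand-back, which C₂^∞ supplies through `settled_of_settledAllOrders` — a base datum exceptional for the Statement's
`C²` clause is exceptional for all-orders settling, and all-orders settled members are `C²`-settled; `mono` re-inserts the
anti-vacuity conjunct from `MGHDExists`).  Together with `subconvergentEraGeneric_of_settlingAllOrdersAlongCensoredKerrEnds`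
this records that ONE statement C₂^∞ feeds both this route's import crux (stmt-17490) and the sibling route's closure
(in place of stmt-18520).  Christodoulou, CQG 16 (1999) A23, p. A24. [cite: Christodoulou1999, p. A24] -/
theorem finalStateConjecture_of_settlingAllOrdersAlongCensoredKerrEnds : TameEscapeToKerrEnds → CensorshipAlongKerrEnds → (∀ (X : Type) [TopologicalSpace X] [ChartedSpace E3 X] [IsManifold (𝓡 3) ∞ X] [T2Space X] [SecondCountableTopology X] [ConnectedSpace X], ∀ (e : AFEnd X) (F : EuclideanSpace ℝ (Fin 1) → InitialDataSet (𝓡 3) X), IsTameDataFamily e 1 F → ((IsImmersedAtZero 1 F ∧ Injective F) ∨ ∀ c, F c = F 0) → (∀ c, F c ∈ admissibleVacuumData X) → (∀ c ≠ 0, (F c).HasExactKerrEnd ∧ ∀ 𝒟 : VacuumCauchyDevelopment (F c), 𝒟.IsMaximal → HasCompleteNullInfinity 𝒟.toCauchyDevelopment) → ¬ (∀ 𝒟 : VacuumCauchyDevelopment (F 0), 𝒟.IsMaximal → HasCompleteNullInfinity 𝒟.toCauchyDevelopment ∧ ∃ (O : Set 𝒟.carrier) (d : FinalStateDecomposition 𝒟.toSpacetime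 O 2), (∀ i, Kerr.IsSubextremal (d.mass i) (d.spin i)) ∧ O = exteriorOf 𝒟.toCauchyDevelopment d.charted ∧ RaysStayInClosure 𝒟.toCauchyDevelopment O ∧ IsFutureOriented d ∧ (∀ k, Tendsto (fun τ => 𝒟.toSpacetime.deviationCk (Minkowski.backgroundOn d.flatDomain) d.flatChart k τ) atTop (𝓝 0)) ∧ (∀ i k (ρ : ℝ), Tendsto (fun τ => 𝒟.toSpacetime.truncDeviationCk (d.background i) (d.chart i) k ρ τ) atTop (𝓝 0)) ∧ ∃ R : Fin d.N → ℝ → ℝ, (∀ i, Tendsto (R i) atTop atTop ∧ ∀ τ, max (Kerr.rPlus (d.mass i) (d.spin i)) 0 + 1 ≤ R i τ) ∧ (∀ i k, Tendsto (fun τ => 𝒟.toSpacetime.truncDeviationCk (d.background i) (d.chart i) k (R i τ) τ) atTop (𝓝 0)) ∧ ∀ τ₁, d.τ₀ < τ₁ → O \ certifiedLate d R τ₁ ⊆ 𝒟.metric.causalPast 𝒟.timeOrientation (certifiedSlab d R τ₁)) → ∃ (e' : AFEnd X) (F' : EuclideanSpace ℝ (Fin 1) → InitialDataSet (𝓡 3)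 X), IsTameDataFamily e' 1 F' ∧ F' 0 = F 0 ∧ Injective F' ∧ IsImmersedAtZero 1 F' ∧ (∀ c, F' c ∈ admissibleVacuumData X) ∧ ∀ c ≠ 0, ∀ 𝒟 : VacuumCauchyDevelopment (F' c), 𝒟.IsMaximal → HasCompleteNullInfinity 𝒟.toCauchyDevelopment ∧ ∃ (O : Set 𝒟.carrier) (d : FinalStateDecomposition 𝒟.toSpacetime O 2), (∀ i, Kerr.IsSubextremal (d.mass i) (d.spin i)) ∧ O = exteriorOf 𝒟.toCauchyDevelopment d.charted ∧ RaysStayInClosure 𝒟.toCauchyDevelopment O ∧ IsFutureOriented d ∧ (∀ k, Tendsto (fun τ => 𝒟.toSpacetime.deviationCk (Minkowski.backgroundOn d.flatDomain) d.flatChart k τ) atTop (𝓝 0)) ∧ (∀ i k (ρ : ℝ), Tendsto (fun τ => 𝒟.toSpacetime.truncDeviationCk (d.background i) (d.chart i) k ρ τ) atTop (𝓝 0)) ∧ ∃ R : Fin d.N → ℝ → ℝ, (∀ i, Tendsto (R i) atTop atTop ∧ ∀ τ, max (Kerr.rPlus (d.mass i) (d.spin i)) 0 + 1 ≤ R i τ)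 ∧ (∀ i k, Tendsto (fun τ => 𝒟.toSpacetime.truncDeviationCk (d.background i) (d.chart i) k (R i τ) τ) atTop (𝓝 0)) ∧ ∀ τ₁, d.τ₀ < τ₁ → O \ certifiedLate d R τ₁ ⊆ 𝒟.metric.causalPast 𝒟.timeOrientation (certifiedSlab d R τ₁)) → Summit.FinalStateConjecture.FinalStateConjecture.Theses.ExactKerrEnds.MGHDExists → FinalStateConjecture := by
  intro hE hC h hM X _ _ _ _ _ _
  have h𝓓 : ∀ d ∈ admissibleVacuumData X, ∃ e : AFEnd X, e.IsSoleEnd ∧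
      ∃ M : ℝ, e.IsStronglyAsymptoticallyFlatDR d M :=
    fun d hd => exists_isSoleEnd_of_mem_admissibleVacuumData hd
  -- step 1 (E, C₁): "Kerr-ended ∧ censored" is tame-generic
  have h1 : Literature.Geometry.Lorentzian.InitialDataSet.IsTameChristodoulouGeneric
      (Literature.Geometry.Lorentzian.admissibleVacuumData X)
      (fun D ↦ (fun D ↦ ∀ [Literature.Geometry.Lorentzian.Kerr.Facts], ∃ (K : Set X) (U : TopologicalSpace.Opens Literature.Geometry.Lorentzian.E3) (M a r₀ : ℝ) (hM : 0 ≤ M) (φ : U → X) (ψ : U → Literature.Geometry.Lorentzian.Kerr.region a r₀) (ν : Literature.Geometry.Lorentzian.NormalField 𝓘(ℝ, Literature.Geometry.Lorentzian.E4) ψ), IsCompact K ∧ Kᶜ ⊆ range φ ∧ Topology.IsOpenEmbedding φ ∧ ContMDiff 𝓘(ℝ, Literature.Geometry.Lorentzian.E3) (𝓡 3) ((⊤ : ℕ∞) : WithTop ℕ∞) φ ∧ Injective ψ ∧ (Literature.Geometry.Lorentzian.Kerr.smoothMetric M a r₀).IsSpacelikeImmersion 𝓘(ℝ, Literature.Geometry.Lorentzian.E3)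 ψ ∧ (Literature.Geometry.Lorentzian.Kerr.smoothMetric M a r₀).IsFutureUnitNormal 𝓘(ℝ, Literature.Geometry.Lorentzian.E3) ((Literature.Geometry.Lorentzian.Kerr.timeOrientation M a r₀ hM).ofLE le_top) ψ ν ∧ (∀ (y : U) (v w : Literature.Geometry.Lorentzian.E3), φ y ∉ K → D.h.inner (φ y) (mfderiv 𝓘(ℝ, Literature.Geometry.Lorentzian.E3) (𝓡 3) φ y v) (mfderiv 𝓘(ℝ, Literature.Geometry.Lorentzian.E3) (𝓡 3) φ y w) = Literature.Geometry.Lorentzian.Kerr.bilin M a (ψ y : Literature.Geometry.Lorentzian.E4) (mfderiv 𝓘(ℝ, Literature.Geometry.Lorentzian.E3) 𝓘(ℝ, Literature.Geometry.Lorentzian.E4) ψ y v) (mfderiv 𝓘(ℝ, Literature.Geometry.Lorentzian.E3) 𝓘(ℝ, Literature.Geometry.Lorentzian.E4) ψ y w)) ∧ (∀ [(Literature.Geometry.Lorentzian.Kerr.smoothMetric M a r₀).HasLeviCivita] (y : U) (v w : Literature.Geometry.Lorentzian.E3), φ y ∉ K → D.k (φ y) (mfderiv 𝓘(ℝ, Literature.Geometry.Lorentzian.E3)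 (𝓡 3) φ y v) (mfderiv 𝓘(ℝ, Literature.Geometry.Lorentzian.E3) (𝓡 3) φ y w) = (Literature.Geometry.Lorentzian.Kerr.smoothMetric M a r₀).secondFundamentalForm 𝓘(ℝ, Literature.Geometry.Lorentzian.E3) ψ ν y v w)) D ∧ (fun D ↦ ∀ 𝒟 : Literature.Geometry.Lorentzian.VacuumCauchyDevelopment D, 𝒟.IsMaximal → Summit.FinalStateConjecture.HasCompleteNullInfinity 𝒟.toCauchyDevelopment) D) 1 :=
    InitialDataSet.isTameChristodoulouGeneric_of_relative' h𝓓 (hE X) (hC X)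
  -- step 2 (C₂^∞ through `settled_of_settledAllOrders`): the Statement's settled clause is tame-generic
  have h2 : IsTameChristodoulouGeneric (admissibleVacuumData X) (fun D => ∀ 𝒟 : VacuumCauchyDevelopment D, 𝒟.IsMaximal → HasCompleteNullInfinity 𝒟.toCauchyDevelopment ∧ ∃ (O : Set 𝒟.carrier) (d : FinalStateDecomposition 𝒟.toSpacetime O 2), (∀ i, Kerr.IsSubextremal (d.mass i) (d.spin i)) ∧ O = exteriorOf 𝒟.toCauchyDevelopment d.charted ∧ RaysStayInClosure 𝒟.toCauchyDevelopment O ∧ HasExhaustiveCharts d ∧ IsFutureOriented d) 1 := by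
    refine InitialDataSet.isTameChristodoulouGeneric_of_relative_exceptional h𝓓 h1 fun e F hF hdich hadm hQ hexc => ?_
    obtain ⟨e', F', hF', h0, hinj, himm, hadm', hS⟩ := h X e F hF hdich hadm hQ fun hall => hexc fun 𝒟 hmax => by
      obtain ⟨hscri, O, d, hsub, hO, hrays, hor, -, -, R, hR, hgrow, hexh⟩ := hall 𝒟 hmax
      exact ⟨hscri, settled_of_settledAllOrders 𝒟 O d hsub hO hrays hor R hR hgrow hexh⟩
    refine ⟨e', F', hF', h0, hinj, himm, hadm', fun c hc 𝒟 hmax => ?_⟩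
    obtain ⟨hscri, O, d, hsub, hO, hrays, hor, -, -, R, hR, hgrow, hexh⟩ := hS c hc 𝒟 hmax
    exact ⟨hscri, settled_of_settledAllOrders 𝒟 O d hsub hO hrays hor R hR hgrow hexh⟩
  -- step 3: anti-vacuity pointwise from MGHD existence
  exact h2.mono fun D hD hsettled => ⟨hM X D hD, hsettled⟩

end Summit.FinalStateConjecture.FinalStateConjecture.Theorems.LogTimeThreeAnnuli.SubconvergentEraGeneric

end
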